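import Literature.Probability.LatticeModels.OnsagerToeplitzProofs
import Literature.Probability.LatticeModels.OnsagerToeplitzDecay
import Literature.Probability.LatticeModels.IsingTorusTransferProofs
import Literature.Probability.LatticeModels.OnsagerYangSandwich
import Literature.Probability.LatticeModels.IsingPeierls
import Literature.Probability.LatticeModels.OnsagerSzego
import HarnessLib

/-!
# The critical point of the square-lattice Ising model: `β_sd ≤ β_c(2)` proved, and `β_c(2) = β_sd`
# reduced to the long-range order of the exact solution

Topic `Probability/LatticeModels`, namespace `Literature.Probability.LatticeModels`. Sibling proof
file of `PlanarIsing.lean` for its named fact `criticalBeta_two` (**crit-ising.S15**: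
`criticalBeta 2 = criticalBetaTwo`, i.e. `β_c(2) = inf {β ≥ 0 | m*(β) > 0} = ½ log(1+√2) = β_sd`,
the self-dual point of Kramers–Wannier duality, `sinh 2β_sd = 1`). The rigorous identification is
Benettin–Gallavotti–Jona-Lasinio–Stella's input c) (G. Benettin, G. Gallavotti, G. Jona-Lasinio,
A. L. Stella, Comm. Math. Phys. **30** (1973) 45–54, §3 c): "the Onsager critical temperature `β_c`
coincides with the 'true' critical temperature [6]"), [6] = J. L. Lebowitz, Comm. Math. Phys. **28**
(1972) 313–321, §III (`β₀ = β_O` for the square lattice, from the decay of the exactly known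
two-point function with periodic boundary conditions, eq. (3.3) there), together with the
Montroll–Potts–Ward long-range order above `β_sd` (BGJS eq. (3.4)).

## State of the tree used here (2026-08-15)

The exact solution on the cylinder is PROVED in the tree up to the Toeplitz determinant:
`torusRowPair_tendsto_toeplitzDet_holds` (`OnsagerToeplitzProofs`: transfer matrix, Kaufman's
rotations, the row correlation `= D_k(φ_β)`), `tendsto_torusRowPair_exists_holds`
(`IsingTorusTransferProofs`, BGJS (3.3)) and Wu's decay `toeplitzDet_onsagerSymbol_exp_decay_holds`
(`OnsagerToeplitzDecay`, `|D_k(φ_β)| ≤ C e^{-ck}` for `0 < β < β_sd`), whence `m*(β) = 0` for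
`0 ≤ β < β_sd` (`OnsagerToeplitz.spontaneousMagnetization_two_eq_zero_of_toeplitz` fed with the two
discharges — used inline below; as a standalone statement it is the sibling
`TorusRowPairDecay.spontaneousMagnetization_two_eq_zero_of_lt_criticalBetaTwo_holds`, Lebowitz's
`β₀ = β_O`). Feeding these into the reductions of `OnsagerYang` / `OnsagerYangProofs` /
`OnsagerToeplitz` gives, sorry-free and with no new named fact:

* the discharges `torusRowPairLimit_sandwich_holds` (BGJS (3.7)) and
  `twoPointFree_eq_twoPointPlus_of_criticalBetaTwo_lt_holds` (BGJS (3.10));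
* **`criticalBetaTwo_le_criticalBeta_two : β_sd ≤ β_c(2)`** — one half of crit-ising.S15, proved
  outright (the defining set of `β_c(2)` is nonempty by Peierls,
  `exists_spontaneousMagnetization_pos_holds`);
* the other half `β_c(2) ≤ β_sd` needs `m*(β) > 0` for every `β > β_sd`, i.e. long-range order.
  Since `D_k(φ_β) = (σ_{(0,0)}σ_{(k,0)})_p(β) ≤ ⟨σ₀σ_{(k,0)}⟩⁺_β → m*(β)²`, it suffices that the
  Toeplitz determinants of Onsager's symbol stay bounded away from `0` along SOME subsequence:
  `criticalBeta_two_of_frequently_le_toeplitzDet` (weakest form), `criticalBeta_two_of_tendsto_toeplitzDet`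
  (`D_k(φ_β) → L > 0`, the form delivered by any strong-Szegő-type theorem, in particular by the
  geometric-class theory of `Literature.Analysis.Toeplitz`), `criticalBeta_two_of_MPW` (from the
  named fact `torusRowPairLimit_tendsto_onsagerYang_sq`, BGJS (3.4), alone; from
  `Literature.Analysis.Toeplitz.strongSzego` alone it is the sibling
  `TorusRowPairDecay.criticalBeta_two_of_strongSzego`);
  likewise `onsager_yang_of_MPW` for crit-ising.S16. Concretely, both need only the strong Szegő
  ASYMPTOTICS OF THE ONE FAMILY OF SYMBOLS `e^{V_β}`, `V_β = onsagerLog β`, `β > β_sd` (the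
  conclusion of `strongSzego` at `V_β`, cf. `szegoAt_onsagerLog_of_strongSzego`; `V_β` has the
  geometric coefficient bound `|V_k| ≤ γ₂^{|k|}`, `OnsagerToeplitz.norm_circleCoeff_onsagerLog_le`).

So `criticalBeta_two` (and `onsager_yang`) now wait on exactly one statement about one explicit
sequence: the `k → ∞` behaviour of `D_k(φ_β)` for `β > β_sd` (Szegő asymptotics; for
`criticalBeta_two` only `liminf > 0`).

## The discharge (added 2026-08-15)

That statement is now a theorem: `Literature.Analysis.Toeplitz.strongSzego_geometric`
(`StrongSzegoGeometric.lean`, the strong Szegő limit theorem for continuous `V` with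
`‖V_k‖ ≤ C r^{|k|}`, `r < 1`) covers `V_β` and gives `D_k(φ_β) → m_O(β)²` for `β > β_sd`, whence the
discharge `torusRowPairLimit_tendsto_onsagerYang_sq_holds` of BGJS (3.4) (`OnsagerSzego.lean`). The
last section feeds it to `criticalBeta_two_of_MPW`:

* **`criticalBeta_two_holds : criticalBeta_two`** — crit-ising.S15, `β_c(2) = ½ log(1+√2)`, PROVED
  (standard axioms only; no hypothesis, no new named fact).

(`onsager_yang`, crit-ising.S16, follows the same way as `onsager_yang_of_MPW
torusRowPairLimit_tendsto_onsagerYang_sq_holds`; a closed proof of it is already in the tree as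
`HighDimTrivialityWickProofs.onsager_yang_of_tree`, so it is not restated here.)

(The conditional reductions of an earlier version of this file that took the Szegő asymptotics at
`V_β` as a HYPOTHESIS — `tendsto_toeplitzDet_onsagerSymbol_of_szegoAt`,
`torusRowPairLimit_tendsto_onsagerYang_sq_of_szegoAt`, `onsager_yang_of_szegoAt`,
`criticalBeta_two_of_szegoAt` — are superseded by the unconditional
`tendsto_toeplitzDet_onsagerSymbol_holds` / `torusRowPairLimit_tendsto_onsagerYang_sq_holds`
(`OnsagerSzego.lean`), `onsager_yang_of_MPW torusRowPairLimit_tendsto_onsagerYang_sq_holds` and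
`criticalBeta_two_holds` below, and were removed on 2026-08-15.)

## References

* H. A. Kramers, G. H. Wannier, Phys. Rev. 60 (1941) 252–262 (the self-dual point).
* J. L. Lebowitz, Comm. Math. Phys. 28 (1972) 313–321, §III.
* G. Benettin, G. Gallavotti, G. Jona-Lasinio, A. L. Stella, Comm. Math. Phys. 30 (1973) 45–54, §3.
* E. W. Montroll, R. B. Potts, J. C. Ward, J. Math. Phys. 4 (1963) 308–322.
* S. Friedli, Y. Velenik, *Statistical Mechanics of Lattice Systems* (CUP 2017), Thm. 3.25, §3.10.1.
-/

noncomputable section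

open Filter Topology

namespace Literature.Probability.LatticeModels

open Literature.Analysis.Toeplitz

/-! ### Discharges now available from the exact solution on the cylinder -/

/-- **BGJS eq. (3.7), discharged** (Benettin–Gallavotti–Jona-Lasinio–Stella, CMP 30 (1973),
eq. (3.7): `⟨σσ⟩^∅ ≤ (σσ)_p ≤ ⟨σσ⟩⁺`, `β ≥ 0`): the named fact `torusRowPairLimit_sandwich` of
`OnsagerYang.lean`, from `torusRowPairLimit_sandwich_of_exists` and the discharged existence of the
periodic limits (BGJS (3.3), `tendsto_torusRowPair_exists_holds`). [cite: BenettinGallavottiJonaLasinioStella1973, eq. (3.7)] -/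
theorem torusRowPairLimit_sandwich_holds : torusRowPairLimit_sandwich :=
  torusRowPairLimit_sandwich_of_exists tendsto_torusRowPair_exists_holds

/-- **BGJS eq. (3.10), discharged** (Benettin–Gallavotti–Jona-Lasinio–Stella, CMP 30 (1973),
eq. (3.10): `⟨σ_xσ_y⟩_a(β) = ⟨σ_xσ_y⟩_+(β)` for `β > β_c`, by Kramers–Wannier duality and
boundary-condition independence at `β* < β_c`): the named fact
`twoPointFree_eq_twoPointPlus_of_criticalBetaTwo_lt` of `OnsagerYang.lean`, from
`twoPointFree_eq_twoPointPlus_of_subcritical` and `m* = 0` on `[0, β_sd)`. [cite: BenettinGallavottiJonaLasinioStella1973, §3, eq. (3.10)] -/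
theorem twoPointFree_eq_twoPointPlus_of_criticalBetaTwo_lt_holds :
    twoPointFree_eq_twoPointPlus_of_criticalBetaTwo_lt :=
  twoPointFree_eq_twoPointPlus_of_subcritical
    (spontaneousMagnetization_two_eq_zero_of_toeplitz torusRowPair_tendsto_toeplitzDet_holds
      toeplitzDet_onsagerSymbol_exp_decay_holds)

/-! ### `β_sd ≤ β_c(2)` -/

/-- **Half of crit-ising.S15, proved: `½ log(1+√2) ≤ β_c(2)`** (Lebowitz, CMP 28 (1972), §III;
BGJS 1973, §3 c); Friedli–Velenik 2017, Thm. 3.25 / §3.10.1). Every `β ≥ 0` with `m*(β) > 0`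
satisfies `β ≥ β_sd` (`m* = 0` below `β_sd`, `OnsagerToeplitz.spontaneousMagnetization_two_eq_zero_of_toeplitz`
with its inputs discharged; `TorusRowPairDecay.spontaneousMagnetization_two_eq_zero_of_lt_criticalBetaTwo_holds`),
and the defining
set of `β_c(2) = inf {β ≥ 0 | m*(β) > 0}` is nonempty by the Peierls argument
(`exists_spontaneousMagnetization_pos_holds`), so the infimum is at least `β_sd`. [cite: Lebowitz1972, §III] -/
theorem criticalBetaTwo_le_criticalBeta_two : criticalBetaTwo ≤ criticalBeta 2 := by
  obtain ⟨β₁, hβ₁0, hβ₁⟩ := exists_spontaneousMagnetization_pos_holds (d := 2) (by norm_num)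
  unfold criticalBeta
  refine le_csInf ⟨β₁, hβ₁0, hβ₁⟩ fun β hβ => ?_
  obtain ⟨hβ0, hpos⟩ := hβ
  by_contra hlt
  exact hpos.ne' (spontaneousMagnetization_two_eq_zero_of_toeplitz torusRowPair_tendsto_toeplitzDet_holds
    toeplitzDet_onsagerSymbol_exp_decay_holds hβ0 (not_le.1 hlt))

/-! ### `β_c(2) ≤ β_sd` from long-range order along a row -/

/-- **Long-range order along a row forces spontaneous magnetisation** (BGJS 1973, eq. (1.5)/(3.5):
`m(β)² = lim_{|x−y|→∞} ⟨σ_xσ_y⟩_+`, Lebowitz–Martin-Löf 1972; Griffiths' criterion). If `β ≥ 0`,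
`c > 0` and `⟨σ₀σ_{(k,0)}⟩⁺_β ≥ c` for infinitely many `k`, then `m*(β) > 0`: the plus two-point
function tends to `m*(β)²` along the cofinite filter
(`twoPointPlus_tendsto_spontaneousMagnetization_sq_holds`), in particular along the row, so
`m*(β)² ≥ c > 0`, and `m*(β) ≥ 0`. [cite: BenettinGallavottiJonaLasinioStella1973, eq. (1.5)] -/
theorem spontaneousMagnetization_two_pos_of_frequently_le_twoPointPlus {β c : ℝ} (hβ : 0 ≤ β)
    (hc : 0 < c) (h : ∃ᶠ k : ℕ in atTop, c ≤ twoPointPlus 2 β ![(k : ℤ), 0]) :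
    0 < spontaneousMagnetization 2 β := by
  have hinj : Function.Injective fun k : ℕ => (![(k : ℤ), 0] : Site 2) := by
    intro a b hab
    have h0 := congr_fun hab 0
    simpa using h0
  have htend : Tendsto (fun k : ℕ => (![(k : ℤ), 0] : Site 2)) atTop cofinite := by
    rw [← Nat.cofinite_eq_atTop]
    exact hinj.tendsto_cofinite
  have hlim : Tendsto (fun k : ℕ => twoPointPlus 2 β ![(k : ℤ), 0]) atTop
      (𝓝 (spontaneousMagnetization 2 β ^ 2)) :=
    (twoPointPlus_tendsto_spontaneousMagnetization_sq_holds (d := 2) hβ).comp htend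
  have hmem : spontaneousMagnetization 2 β ^ 2 ∈ Set.Ici c :=
    isClosed_Ici.mem_of_frequently_of_tendsto h hlim
  have hsq : 0 < spontaneousMagnetization 2 β ^ 2 := hc.trans_le hmem
  have hnn : 0 ≤ spontaneousMagnetization 2 β := spontaneousMagnetization_nonneg_holds (d := 2) hβ
  rcases hnn.eq_or_lt with h0 | hpos
  · rw [← h0] at hsq
    norm_num at hsq
  · exact hpos

/-- **crit-ising.S15 from long-range order above `β_sd`** (BGJS 1973, §3: for `β > β_c`,
`m(β)² = lim ⟨σσ⟩_+ = m_O(β)² > 0`, with c)). If for every `β > β_sd` the plus row two-point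
function `⟨σ₀σ_{(k,0)}⟩⁺_β` is bounded below by a positive constant for infinitely many `k`, then
`criticalBeta 2 = criticalBetaTwo`: such `β` have `m*(β) > 0`, so `β_c(2) ≤ β` for all `β > β_sd`,
and `β_sd ≤ β_c(2)` is `criticalBetaTwo_le_criticalBeta_two`. [cite: BenettinGallavottiJonaLasinioStella1973, §3 c)] -/
theorem criticalBeta_two_of_frequently_le_twoPointPlus
    (h : ∀ ⦃β : ℝ⦄, criticalBetaTwo < β →
      ∃ c : ℝ, 0 < c ∧ ∃ᶠ k : ℕ in atTop, c ≤ twoPointPlus 2 β ![(k : ℤ), 0]) :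
    criticalBeta_two := by
  have hpos : ∀ ⦃β : ℝ⦄, criticalBetaTwo < β → 0 < spontaneousMagnetization 2 β := fun β hβ => by
    obtain ⟨c, hc, hfr⟩ := h hβ
    exact spontaneousMagnetization_two_pos_of_frequently_le_twoPointPlus
      (criticalBetaTwo_pos.trans hβ).le hc hfr
  change criticalBeta 2 = criticalBetaTwo
  refine le_antisymm ?_ criticalBetaTwo_le_criticalBeta_two
  unfold criticalBeta
  refine le_of_forall_gt_imp_ge_of_dense fun β hβ => ?_
  exact csInf_le ⟨0, fun b hb => hb.1⟩ ⟨(criticalBetaTwo_pos.trans hβ).le, hpos hβ⟩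

/-- **crit-ising.S15 from the Toeplitz determinants, weakest form** (Montroll–Potts–Ward 1963 /
BGJS 1973, eq. (3.4) with (3.7): `(σ_{(0,0)}σ_{(k,0)})_p(β) = D_k(φ_β) ≤ ⟨σ₀σ_{(k,0)}⟩⁺_β`). If for
every `β > β_sd` there is `c > 0` with `Re D_k(φ_β) ≥ c` for infinitely many `k` — `D_k(φ_β)` the
Toeplitz determinant of Onsager's symbol, real and equal to the periodic row limit by the
discharged identity `torusRowPair_tendsto_toeplitzDet_holds` — then `criticalBeta 2 = criticalBetaTwo`.
Only this `liminf`-type positivity of the exact solution is needed for the critical point, not the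
Szegő limit itself. [cite: MontrollPottsWard1963, §§3–4 (row correlation = Toeplitz determinant; long-range order)] -/
theorem criticalBeta_two_of_frequently_le_toeplitzDet
    (h : ∀ ⦃β : ℝ⦄, criticalBetaTwo < β → ∃ c : ℝ, 0 < c ∧
      ∃ᶠ k : ℕ in atTop, c ≤ (toeplitzDet (circleCoeff (onsagerSymbol β)) k).re) :
    criticalBeta_two := by
  refine criticalBeta_two_of_frequently_le_twoPointPlus fun β hβ => ?_
  obtain ⟨c, hc, hfr⟩ := h hβ
  have hβ0 : 0 < β := criticalBetaTwo_pos.trans hβ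
  refine ⟨c, hc, hfr.mono fun k hk => hk.trans ?_⟩
  have hre : (toeplitzDet (circleCoeff (onsagerSymbol β)) k).re = torusRowPairLimit β k := by
    rw [← torusRowPairLimit_eq_toeplitzDet torusRowPair_tendsto_toeplitzDet_holds hβ0 hβ.ne' k,
      Complex.ofReal_re]
  rw [hre]
  exact (torusRowPairLimit_sandwich_at hβ0.le
    (tendsto_torusRowPair_outer_of_toeplitz torusRowPair_tendsto_toeplitzDet_holds hβ0 hβ.ne' k)).2

/-- **crit-ising.S15 from a Szegő-type limit of the exact solution** (Montroll–Potts–Ward 1963: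
`D_k(φ_β) → m_O(β)² > 0` for `β > β_sd`, by Szegő's theorem; BGJS 1973, eq. (3.4)). If for every
`β > β_sd` the Toeplitz determinants `D_k(φ_β)` of Onsager's symbol converge to a positive real
limit, then `criticalBeta 2 = criticalBetaTwo`. (The form in which any strong Szegő limit theorem
covering the symbol `φ_β`, e.g. for geometrically decaying Fourier data, closes `criticalBeta_two`.) [cite: MontrollPottsWard1963, main formula (long-range order via Szegő's theorem)] -/
theorem criticalBeta_two_of_tendsto_toeplitzDet
    (h : ∀ ⦃β : ℝ⦄, criticalBetaTwo < β → ∃ L : ℝ, 0 < L ∧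
      Tendsto (fun k : ℕ => toeplitzDet (circleCoeff (onsagerSymbol β)) k) atTop (𝓝 (L : ℂ))) :
    criticalBeta_two := by
  refine criticalBeta_two_of_frequently_le_toeplitzDet fun β hβ => ?_
  obtain ⟨L, hL, ht⟩ := h hβ
  have hre : Tendsto (fun k : ℕ => (toeplitzDet (circleCoeff (onsagerSymbol β)) k).re) atTop
      (𝓝 ((L : ℂ).re)) :=
    ((Complex.continuous_re.tendsto _).comp ht).congr fun _ => rfl
  rw [Complex.ofReal_re] at hre
  exact ⟨L / 2, half_pos hL,
    ((hre.eventually (lt_mem_nhds (half_lt_self hL))).mono fun k hk => hk.le).frequently⟩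

/-! ### The remaining single input: BGJS (3.4), the Montroll–Potts–Ward long-range order -/

/-- **crit-ising.S15 from BGJS (3.4) alone** (Benettin–Gallavotti–Jona-Lasinio–Stella, CMP 30
(1973), §3 c) with eq. (3.4); Lebowitz 1972, §III): granting the Montroll–Potts–Ward long-range
order of the periodic lattice, `(σ_{(0,0)}σ_{(k,0)})_p(β) → m_O(β)²` for `β > β_sd` (the named fact
`torusRowPairLimit_tendsto_onsagerYang_sq`), `criticalBeta 2 = criticalBetaTwo` — the other two
inputs of `criticalBeta_two_of_exactSolution_of_subcritical` (BGJS (3.3) and `m* = 0` below `β_sd`)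
being theorems now. [cite: BenettinGallavottiJonaLasinioStella1973, §3 c) with eq. (3.4)] -/
theorem criticalBeta_two_of_MPW (hMPW : torusRowPairLimit_tendsto_onsagerYang_sq) :
    criticalBeta_two :=
  criticalBeta_two_of_exactSolution_of_subcritical tendsto_torusRowPair_exists_holds hMPW
    (spontaneousMagnetization_two_eq_zero_of_toeplitz torusRowPair_tendsto_toeplitzDet_holds
      toeplitzDet_onsagerSymbol_exp_decay_holds)

/-- **crit-ising.S16 from BGJS (3.4) alone** (Benettin–Gallavotti–Jona-Lasinio–Stella, CMP 30
(1973), §3, main result): granting only the Montroll–Potts–Ward long-range order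
`torusRowPairLimit_tendsto_onsagerYang_sq`, the Onsager–Yang formula `onsager_yang` holds — all other
inputs of `onsager_yang_of_exactSolution_of_subcritical` are theorems now. [cite: BenettinGallavottiJonaLasinioStella1973, §3 (main result)] -/
theorem onsager_yang_of_MPW (hMPW : torusRowPairLimit_tendsto_onsagerYang_sq) : onsager_yang :=
  onsager_yang_of_exactSolution_of_subcritical tendsto_torusRowPair_exists_holds hMPW
    (spontaneousMagnetization_two_eq_zero_of_toeplitz torusRowPair_tendsto_toeplitzDet_holds
      toeplitzDet_onsagerSymbol_exp_decay_holds)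

/-! ### The Szegő asymptotics at Onsager's symbol as a special case of `strongSzego` -/

/-- **The Szegő hypothesis at Onsager's symbol is a special case of `strongSzego`**: the strong
Szegő limit theorem (`Literature.Analysis.Toeplitz.strongSzego`, Deift–Its–Krasovsky 2013, §3,
Thm. 7) applied to `V = V_β = onsagerLog β`, `β > β_sd` (continuous, `2π`-periodic, with
`∑ |k| |V_k|² < ∞` by the geometric bound `|V_k| ≤ γ₂^{|k|}`, `norm_circleCoeff_onsagerLog_le`),
gives `D_n(e^{V_β}) / e^{n (V_β)_0} → exp(∑_{k≥1} k (V_β)_k (V_β)_{-k})`. Recorded to show that these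
asymptotics — proved outright for this geometrically decaying symbol by
`Literature.Analysis.Toeplitz.strongSzego_geometric`, whence `D_n(φ_β) → m_O(β)²`
(`tendsto_toeplitzDet_onsagerSymbol_holds`) and BGJS (3.4)
(`torusRowPairLimit_tendsto_onsagerYang_sq_holds`, both `OnsagerSzego.lean`) — are also the special
case `V = V_β` of the general named fact. [cite: DeiftItsKrasovsky2013, §3, Theorem 7] -/
theorem szegoAt_onsagerLog_of_strongSzego (hSz : strongSzego) ⦃β : ℝ⦄ (hβ : criticalBetaTwo < β) :
    Tendsto (fun n : ℕ => toeplitzDet (circleCoeff fun θ => Complex.exp (onsagerLog β θ)) n /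
        Complex.exp (n * circleCoeff (onsagerLog β) 0)) atTop
      (𝓝 (Complex.exp (∑' k : ℕ, ((k : ℂ) + 1) * circleCoeff (onsagerLog β) ((k : ℤ) + 1) *
        circleCoeff (onsagerLog β) (-((k : ℤ) + 1))))) :=
  hSz (onsagerLog β) (continuous_onsagerLog hβ) (onsagerLog_periodic β)
    (summable_abs_mul_norm_sq_circleCoeff_onsagerLog onsagerLog_circleCoeff_holds hβ)

/-! ### The discharge: `β_c(2) = ½ log (1 + √2)` -/

/-- **crit-ising.S15, proved: `criticalBeta 2 = criticalBetaTwo`** — the critical inverse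
temperature `β_c(2) = inf {β ≥ 0 | m*(β) > 0}` of the nearest-neighbour Ising model on `ℤ²` is the
Kramers–Wannier self-dual point `½ log (1 + √2)` (`sinh 2β = 1`; H. A. Kramers, G. H. Wannier,
Phys. Rev. **60** (1941) 252–262, Part I: the duality argument locating the Curie point, heuristic;
S. Friedli, Y. Velenik 2017, §3.10.1, eq. (3.63): "That the inverse critical temperature of the
Ising model on `ℤ²` actually coincides with the self-dual point of this transformation follows from
the exact expression for the pressure derived by Onsager"). The proof is the exact-solution route of
Benettin–Gallavotti–Jona-Lasinio–Stella, CMP **30** (1973), §3 c) ("the Onsager critical temperature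
`β_c` coincides with the 'true' critical temperature [6]", [6] = J. L. Lebowitz, CMP **28** (1972),
§III, p. 320): `criticalBeta_two_of_MPW` above — `β_sd ≤ β_c(2)` from `m* = 0` below `β_sd` (Wu's
decay of `D_k(φ_β)`, `toeplitzDet_onsagerSymbol_exp_decay_holds`, through the Toeplitz form of the
cylinder row correlations, `torusRowPair_tendsto_toeplitzDet_holds`), and `β_c(2) ≤ β_sd` from
long-range order above `β_sd` — fed with the Montroll–Potts–Ward long-range order
`torusRowPairLimit_tendsto_onsagerYang_sq_holds` (BGJS (3.4), `OnsagerSzego.lean`: the Toeplitz form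
and the strong Szegő limit theorem for geometrically decaying symbols,
`Literature.Analysis.Toeplitz.strongSzego_geometric`, both proved). Every input is a theorem of the
tree. [cite: KramersWannier1941, Part I (location of the Curie point by self-duality)] [cite: Lebowitz1972, §III, p. 320] [cite: BenettinGallavottiJonaLasinioStella1973, §3 c) with eq. (3.4)] -/
theorem criticalBeta_two_holds : criticalBeta_two :=
  criticalBeta_two_of_MPW torusRowPairLimit_tendsto_onsagerYang_sq_holds

end Literature.Probability.LatticeModels
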